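import Summits.CriticalPhenomena.PercolationContinuityZ3.Theorems.SahiMasterFamilySaturation

/-!
# Local trichotomy for terminal triples, II': double saturation forces the triangle (SS, conclusion)

Companion of `SahiMasterFamilyTrichotomy.lean` (unit `prim-master-conj`; terminal analysis of (T), paper
STRUCTURE-PROOF.md §4 Lemma SS, verified VERIFICATION-gen3.md).  For a triple of increasing events with pairwise
intersecting essential supports, no private and no common coordinate, all of whose minors lie in `Z_3`:

* `lemma_SS` — if a shared coordinate `e ∈ esupp A ∩ esupp B` saturates both `A` and `B` and is mandatory for
  neither, then the triple is THE TRIANGLE: `esupp A = {e, s}`, `esupp B = {e, t}`, `esupp C = {s, t}` and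
  `A = {e ∨ s}`, `B = {e ∨ t}`, `C = {s ∨ t}` (`orPair`).
The proof follows the paper: the deletion at `e` is realised by `(A_e, B_e)`, which pins the supports
(`esupp A_e = esupp A ∩ esupp C`, `esupp B_e = esupp B ∩ esupp C`); the Lemma-Z side conditions and a downward induction
put the configurations `esupp A ∩ esupp C` and `esupp B ∩ esupp C` into `C`; the minors at `s ∈ esupp A ∩ esupp C` give
`C_s ⊆ B` and "`C^s` ignores `esupp B ∩ esupp C`", whence every singleton of `esupp C` lies in `C` and the classes are
singletons.  Everything here is proved; axioms standard. [this work]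
-/

noncomputable section

open scoped Classical

namespace Summit.CriticalPhenomena.PercolationContinuityZ3.Theorems

open Finset Function
open Literature.Probability.Percolation (DeterminedBy determinedBy_iff)
open Literature.Probability.LatticeModels.Kahn2022 (Affects)

variable {ι : Type*} [Fintype ι]

/-! ### SS -/

/-- **SS (double saturation forces the triangle).**  Let `A, B, C` be increasing events with pairwise-intersecting
essential supports, no private coordinate, no coordinate common to all three supports, and ALL minors in `Z_3`.  If
`e ∈ esupp A` (not affecting `C`) saturates both `A` and `B` and is mandatory for neither, then for some `s, t`:
`esupp A = {e, s}`, `esupp B = {e, t}`, `esupp C = {s, t}`, and `A = {e ∨ s}`, `B = {e ∨ t}`, `C = {s ∨ t}`.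
[this work] -/
theorem lemma_SS {A B C : Set (Set ι)} (hA : IsUpperSet A) (hB : IsUpperSet B) (hC : IsUpperSet C)
    (hAC : (esupp A ∩ esupp C).Nonempty) (hBC : (esupp B ∩ esupp C).Nonempty)
    (hprivA : esupp A ⊆ esupp B ∪ esupp C) (hprivB : esupp B ⊆ esupp A ∪ esupp C)
    (hprivC : esupp C ⊆ esupp A ∪ esupp B) (hcommon : ∀ i, i ∈ esupp A → i ∈ esupp B → i ∉ esupp C)
    (hmin : ∀ i ∈ esupp A ∪ esupp B ∪ esupp C, ∀ b : Bool, SuppZeroFlag 3 ![secAt i b A, secAt i b B, secAt i b C])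
    {e : ι} (heA : e ∈ esupp A) (heB : e ∈ esupp B)
    (hA0 : (secAt e false A).Nonempty) (hB0 : (secAt e false B).Nonempty)
    (hsatA : secAt e true A = Set.univ) (hsatB : secAt e true B = Set.univ) :
    ∃ s t : ι, esupp A = {e, s} ∧ esupp B = {e, t} ∧ esupp C = {s, t} ∧
      A = orPair e s ∧ B = orPair e t ∧ C = orPair s t := by
  have heC : e ∉ esupp C := hcommon e heA heB
  have hA0u : IsUpperSet (secAt e false A) := isUpperSet_secAt e false hA
  have hB0u : IsUpperSet (secAt e false B) := isUpperSet_secAt e false hB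
  have hCne : C.Nonempty := by
    obtain ⟨i, hi⟩ := hAC; exact (nonempty_of_esupp_nonempty ⟨i, (mem_inter.1 hi).2⟩).1
  have hCnu : C ≠ Set.univ := by
    obtain ⟨i, hi⟩ := hAC; exact (nonempty_of_esupp_nonempty ⟨i, (mem_inter.1 hi).2⟩).2
  have hAnu : A ≠ Set.univ := (nonempty_of_esupp_nonempty ⟨e, heA⟩).2
  have hBnu : B ≠ Set.univ := (nonempty_of_esupp_nonempty ⟨e, heB⟩).2
  have esA0 : esupp (secAt e false A) = (esupp A).erase e := esupp_secAt_false_of_saturates hA hsatA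
  have esB0 : esupp (secAt e false B) = (esupp B).erase e := esupp_secAt_false_of_saturates hB hsatB
  obtain ⟨esA0', esB0', esC, hIACmem, hIBCmem, delB, delA⟩ :=
    ss_partA hA hB hC hAC hBC hprivA hprivB hprivC hcommon hmin heA heB hA0 hB0 hsatA hsatB
  set IAC := esupp A ∩ esupp C with hIAC
  set IBC := esupp B ∩ esupp C with hIBC
  have hIAC_B : Disjoint IAC (esupp B) := by
    rw [Finset.disjoint_left]
    intro f hf hfB
    exact hcommon f (mem_inter.1 hf).1 hfB (mem_inter.1 hf).2
  have hIBC_A : Disjoint IBC (esupp A) := by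
    rw [Finset.disjoint_left]
    intro f hf hfA
    exact hcommon f hfA (mem_inter.1 hf).1 (mem_inter.1 hf).2
  have hsat_mem : ∀ {X : Set (Set ι)}, IsUpperSet X → secAt e true X = Set.univ → ∀ {s : ι}, s ≠ e →
      ∀ b : Bool, ({e} : Set ι) ∈ secAt s b X := by
    intro X hX hsat s hse b
    rw [mem_secAt]
    have hsing : ({e} : Set ι) ∈ X := (secAt_true_eq_univ_iff' hX e).1 hsat
    cases b
    · simp only [forceAt, cond_false]
      rwa [Set.sdiff_singleton_eq_self (show s ∉ ({e} : Set ι) from fun h => hse h)]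
    · simp only [forceAt, cond_true]
      exact hX (Set.subset_insert s {e}) hsing
  have hempty_not : ∀ {X : Set (Set ι)}, X ≠ Set.univ → ∀ (s : ι) (b : Bool), IsUpperSet X →
      (b = true → ({s} : Set ι) ∉ X) → (∅ : Set ι) ∉ secAt s b X := by
    intro X hX s b hXu hb h
    rw [mem_secAt] at h
    cases b
    · simp only [forceAt, cond_false, Set.empty_sdiff] at h
      exact hX (Set.eq_univ_of_forall fun η => hXu (Set.empty_subset η) h)
    · simp only [forceAt, cond_true, insert_empty_eq] at h
      exact hb rfl h
  -- Step 5a: for `s ∈ IAC`, `C^s` ignores `IBC`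
  have hsingB : ({e} : Set ι) ∈ B := (secAt_true_eq_univ_iff' hB e).1 hsatB
  have hsingA : ({e} : Set ι) ∈ A := (secAt_true_eq_univ_iff' hA e).1 hsatA
  have dIAB : Disjoint IAC IBC := Finset.disjoint_of_subset_right (Finset.inter_subset_left) hIAC_B
  have conIBC : ∀ s ∈ IAC, Disjoint (esupp (secAt s true C)) IBC := by
    intro s hs
    have hsC := (mem_inter.1 hs).2
    have hse : s ≠ e := fun hse => heC (hse ▸ hsC)
    have hsB : s ∉ esupp B := fun h => hcommon s (mem_inter.1 hs).1 h hsC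
    have hm := hmin s (by simp [(mem_inter.1 hs).1]) true
    rw [secAt_eq_self_of_not_affects hB (fun h => hsB (mem_esupp.2 h)) true] at hm
    have hAs : IsUpperSet (secAt s true A) := isUpperSet_secAt s true hA
    have hCs : IsUpperSet (secAt s true C) := isUpperSet_secAt s true hC
    -- `C^s ⊆ B` is impossible
    have notsub : ¬ (∀ ω ∈ secAt s true C, ω ∈ B) := by
      intro hsub
      have h1 : (↑(IAC.erase s) : Set ι) ∈ secAt s true C := by
        rw [mem_secAt]; simp only [forceAt, cond_true]
        rwa [coe_erase, Set.insert_sdiff_singleton, Set.insert_eq_of_mem (mem_coe.2 hs)]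
      refine not_mem_of_disjoint_esupp hB hBnu ?_ (hsub _ h1)
      ext i
      simp only [Set.mem_inter_iff, mem_coe, mem_erase, Set.mem_empty_iff_false, iff_false, not_and, and_imp]
      exact fun _ hiP hiB => Finset.disjoint_left.1 hIAC_B hiP hiB
    have key : Disjoint (esupp B) (esupp (secAt s true C)) := by
      by_cases heAs : e ∈ esupp (secAt s true A)
      · rcases (suppZeroFlag_three_iff_zVia _ _ _).1 hm with h | h | h
        · exact (zVia_pivotal hB hCs hAs h).1
        · exfalso
          obtain ⟨-, -, p2⟩ := zVia_pivotal hAs hCs hB h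
          exact notsub fun ω hω => by_contra fun hωB =>
            p2 e heAs ω hω hωB (hB (Set.singleton_subset_iff.2 (Set.mem_insert e ω)) hsingB)
        · exfalso; exact Finset.disjoint_left.1 (zVia_pivotal hAs hB hCs h).1 heAs heB
      · -- `A^s` does not depend on `e`, hence is `univ`
        have h0 : (∅ : Set ι) ∈ secAt s true A := by
          have := hsat_mem hA hsatA hse true
          rwa [← insert_empty_eq, insert_mem_iff_of_not_affects hAs (fun h => heAs (mem_esupp.2 h))] at this
        have hu : secAt s true A = Set.univ := Set.eq_univ_of_forall fun η => hAs (Set.empty_subset η) h0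
        rw [hu] at hm
        exact disjoint_of_suppZeroFlag_three_univ hB hCs hm
    exact disjoint_comm.1 (Finset.disjoint_of_subset_left Finset.inter_subset_left key)
  -- Step 5b: for `t ∈ IBC`, `C^t` ignores `IAC`
  have conIAC : ∀ t ∈ IBC, Disjoint (esupp (secAt t true C)) IAC := by
    intro t ht
    have htC := (mem_inter.1 ht).2
    have hte : t ≠ e := fun hte => heC (hte ▸ htC)
    have htA : t ∉ esupp A := fun h => hcommon t h (mem_inter.1 ht).1 htC
    have hm := hmin t (by simp [(mem_inter.1 ht).1]) true
    rw [secAt_eq_self_of_not_affects hA (fun h => htA (mem_esupp.2 h)) true] at hm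
    have hBt : IsUpperSet (secAt t true B) := isUpperSet_secAt t true hB
    have hCt : IsUpperSet (secAt t true C) := isUpperSet_secAt t true hC
    have notsub : ¬ (∀ ω ∈ secAt t true C, ω ∈ A) := by
      intro hsub
      have h1 : (↑(IBC.erase t) : Set ι) ∈ secAt t true C := by
        rw [mem_secAt]; simp only [forceAt, cond_true]
        rwa [coe_erase, Set.insert_sdiff_singleton, Set.insert_eq_of_mem (mem_coe.2 ht)]
      refine not_mem_of_disjoint_esupp hA hAnu ?_ (hsub _ h1)
      ext i
      simp only [Set.mem_inter_iff, mem_coe, mem_erase, Set.mem_empty_iff_false, iff_false, not_and, and_imp]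
      exact fun _ hiP hiA => Finset.disjoint_left.1 hIBC_A hiP hiA
    have key : Disjoint (esupp A) (esupp (secAt t true C)) := by
      by_cases heBt : e ∈ esupp (secAt t true B)
      · rcases (suppZeroFlag_three_iff_zVia _ _ _).1 hm with h | h | h
        · exfalso
          obtain ⟨-, -, p2⟩ := zVia_pivotal hBt hCt hA h
          exact notsub fun ω hω => by_contra fun hωA =>
            p2 e heBt ω hω hωA (hA (Set.singleton_subset_iff.2 (Set.mem_insert e ω)) hsingA)
        · exact (zVia_pivotal hA hCt hBt h).1
        · exfalso; exact Finset.disjoint_left.1 (zVia_pivotal hA hBt hCt h).1 heA heBt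
      · have h0 : (∅ : Set ι) ∈ secAt t true B := by
          have := hsat_mem hB hsatB hte true
          rwa [← insert_empty_eq, insert_mem_iff_of_not_affects hBt (fun h => heBt (mem_esupp.2 h))] at this
        have hu : secAt t true B = Set.univ := Set.eq_univ_of_forall fun η => hBt (Set.empty_subset η) h0
        rw [hu] at hm
        exact disjoint_of_suppZeroFlag_three_univ hA hCt ((suppZeroFlag_three_swap12 hA isUpperSet_univ hCt).1 hm)
    exact disjoint_comm.1 (Finset.disjoint_of_subset_left Finset.inter_subset_left key)
  -- Step 6: every singleton of `esupp C` lies in `C`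
  have singles : ∀ s ∈ IAC, ∀ t ∈ IBC, ({s} : Set ι) ∈ C ∧ ({t} : Set ι) ∈ C := by
    intro s hs t ht
    have hsIBC : s ∉ IBC := fun h => Finset.disjoint_left.1 dIAB hs h
    have htIAC : t ∉ IAC := fun h => Finset.disjoint_left.1 dIAB h ht
    have hCs : IsUpperSet (secAt s true C) := isUpperSet_secAt s true hC
    have hCt : IsUpperSet (secAt t true C) := isUpperSet_secAt t true hC
    -- ω = IAC ∪ {t} lies in C (use `C^s` ignores IBC)
    have hω : insert t (↑IAC : Set ι) ∈ C := by
      have hsω : s ∈ insert t (↑IAC : Set ι) := Set.mem_insert_of_mem t (mem_coe.2 hs)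
      rw [← mem_secAt_true_iff_of_mem hsω, mem_iff_sdiff_mem hCs (conIBC s hs),
        show insert t (↑IAC : Set ι) \ ↑IBC = ↑IAC by
          ext i
          simp only [Set.mem_sdiff, Set.mem_insert_iff, mem_coe]
          constructor
          · rintro ⟨rfl | hi, hni⟩
            · exact absurd ht hni
            · exact hi
          · intro hi; exact ⟨Or.inr hi, fun hiB => Finset.disjoint_left.1 dIAB hi hiB⟩,
        mem_secAt_true_iff_of_mem (mem_coe.2 hs)]
      exact hIACmem
    -- and then `{t} ∈ C` (use `C^t` ignores IAC)
    have ht1 : ({t} : Set ι) ∈ C := by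
      have htω : t ∈ insert t (↑IAC : Set ι) := Set.mem_insert t _
      rw [← mem_secAt_true_iff_of_mem htω, mem_iff_sdiff_mem hCt (conIAC t ht),
        show insert t (↑IAC : Set ι) \ ↑IAC = {t} by
          ext i
          simp only [Set.mem_sdiff, Set.mem_insert_iff, mem_coe, Set.mem_singleton_iff]
          constructor
          · rintro ⟨rfl | hi, hni⟩
            · rfl
            · exact absurd hi hni
          · rintro rfl; exact ⟨Or.inl rfl, htIAC⟩,
        mem_secAt_true_iff_of_mem (Set.mem_singleton t)] at hω
      exact hω
    -- symmetrically `{s} ∈ C`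
    have hω' : insert s (↑IBC : Set ι) ∈ C := by
      have htω : t ∈ insert s (↑IBC : Set ι) := Set.mem_insert_of_mem s (mem_coe.2 ht)
      rw [← mem_secAt_true_iff_of_mem htω, mem_iff_sdiff_mem hCt (conIAC t ht),
        show insert s (↑IBC : Set ι) \ ↑IAC = ↑IBC by
          ext i
          simp only [Set.mem_sdiff, Set.mem_insert_iff, mem_coe]
          constructor
          · rintro ⟨rfl | hi, hni⟩
            · exact absurd hs hni
            · exact hi
          · intro hi; exact ⟨Or.inr hi, fun hiA => Finset.disjoint_left.1 dIAB hiA hi⟩,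
        mem_secAt_true_iff_of_mem (mem_coe.2 ht)]
      exact hIBCmem
    have hs1 : ({s} : Set ι) ∈ C := by
      have hsω : s ∈ insert s (↑IBC : Set ι) := Set.mem_insert s _
      rw [← mem_secAt_true_iff_of_mem hsω, mem_iff_sdiff_mem hCs (conIBC s hs),
        show insert s (↑IBC : Set ι) \ ↑IBC = {s} by
          ext i
          simp only [Set.mem_sdiff, Set.mem_insert_iff, mem_coe, Set.mem_singleton_iff]
          constructor
          · rintro ⟨rfl | hi, hni⟩
            · rfl
            · exact absurd hi hni
          · rintro rfl; exact ⟨Or.inl rfl, hsIBC⟩,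
        mem_secAt_true_iff_of_mem (Set.mem_singleton s)] at hω'
      exact hω'
    exact ⟨hs1, ht1⟩
  -- Step 7: the classes are singletons
  obtain ⟨s₀, hs₀⟩ := hAC
  obtain ⟨t₀, ht₀⟩ := hBC
  have hIAC1 : IAC = {s₀} := by
    refine Finset.eq_singleton_iff_unique_mem.2 ⟨hs₀, fun s' hs' => ?_⟩
    by_contra hne
    have hs'C : ({s'} : Set ι) ∈ C := (singles s' hs' t₀ ht₀).1
    have hs'B : s' ∉ esupp B := fun h => hcommon s' (mem_inter.1 hs').1 h (mem_inter.1 hs').2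
    have h1 : ({s'} : Set ι) ∈ secAt s₀ false C :=
      (mem_secAt_false_iff_of_notMem (show s₀ ∉ ({s'} : Set ι) from fun h => hne h.symm)).2 hs'C
    refine not_mem_of_disjoint_esupp hB hBnu ?_ (delB s₀ hs₀ _ h1)
    ext i
    simp only [Set.mem_inter_iff, Set.mem_singleton_iff, mem_coe, Set.mem_empty_iff_false, iff_false, not_and]
    rintro rfl; exact hs'B
  have hIBC1 : IBC = {t₀} := by
    refine Finset.eq_singleton_iff_unique_mem.2 ⟨ht₀, fun t' ht' => ?_⟩
    by_contra hne
    have ht'C : ({t'} : Set ι) ∈ C := (singles s₀ hs₀ t' ht').2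
    have ht'A : t' ∉ esupp A := fun h => hcommon t' h (mem_inter.1 ht').1 (mem_inter.1 ht').2
    have h1 : ({t'} : Set ι) ∈ secAt t₀ false C :=
      (mem_secAt_false_iff_of_notMem (show t₀ ∉ ({t'} : Set ι) from fun h => hne h.symm)).2 ht'C
    refine not_mem_of_disjoint_esupp hA hAnu ?_ (delA t₀ ht₀ _ h1)
    ext i
    simp only [Set.mem_inter_iff, Set.mem_singleton_iff, mem_coe, Set.mem_empty_iff_false, iff_false, not_and]
    rintro rfl; exact ht'A
  -- Step 8: the explicit events
  have hs₀C : ({s₀} : Set ι) ∈ C := (singles s₀ hs₀ t₀ ht₀).1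
  have ht₀C : ({t₀} : Set ι) ∈ C := (singles s₀ hs₀ t₀ ht₀).2
  refine ⟨s₀, t₀, ?_, ?_, ?_, ?_, ?_, ?_⟩
  · rw [← Finset.insert_erase heA, ← esA0, esA0', hIAC1]
  · rw [← Finset.insert_erase heB, ← esB0, esB0', hIBC1]
  · rw [esC, hIAC1, hIBC1]; rfl
  · -- `A = {e ∨ s₀}`
    have hA0ne : secAt e false A ≠ Set.univ := by
      intro h
      have : (∅ : Set ι) ∈ secAt e false A := by rw [h]; exact Set.mem_univ _
      exact hempty_not hAnu e false hA (fun h' => absurd h' Bool.false_ne_true) this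
    ext ω
    rw [mem_iff_of_saturates hA hsatA]
    simp only [orPair, Set.mem_setOf_eq]
    constructor
    · rintro (he | hω)
      · exact Or.inl he
      · right
        by_contra hs
        refine not_mem_of_disjoint_esupp hA0u hA0ne ?_ hω
        rw [esA0', hIAC1]; ext i; simp only [Set.mem_inter_iff, mem_coe, Finset.mem_singleton,
          Set.mem_empty_iff_false, iff_false, not_and]
        rintro hi rfl; exact hs hi
    · rintro (he | hs)
      · exact Or.inl he
      · have h1 : ({s₀} : Set ι) ∈ secAt e false A :=
          mem_of_esupp_subset hA0u hA0 (by rw [esA0', hIAC1]; simp)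
        exact Or.inr (hA0u (Set.singleton_subset_iff.2 hs) h1)
  · -- `B = {e ∨ t₀}`
    have hB0ne : secAt e false B ≠ Set.univ := by
      intro h
      have : (∅ : Set ι) ∈ secAt e false B := by rw [h]; exact Set.mem_univ _
      exact hempty_not hBnu e false hB (fun h' => absurd h' Bool.false_ne_true) this
    ext ω
    rw [mem_iff_of_saturates hB hsatB]
    simp only [orPair, Set.mem_setOf_eq]
    constructor
    · rintro (he | hω)
      · exact Or.inl he
      · right
        by_contra ht
        refine not_mem_of_disjoint_esupp hB0u hB0ne ?_ hω
        rw [esB0', hIBC1]; ext i; simp only [Set.mem_inter_iff, mem_coe, Finset.mem_singleton,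
          Set.mem_empty_iff_false, iff_false, not_and]
        rintro hi rfl; exact ht hi
    · rintro (he | ht)
      · exact Or.inl he
      · have h1 : ({t₀} : Set ι) ∈ secAt e false B :=
          mem_of_esupp_subset hB0u hB0 (by rw [esB0', hIBC1]; simp)
        exact Or.inr (hB0u (Set.singleton_subset_iff.2 ht) h1)
  · -- `C = {s₀ ∨ t₀}`
    ext ω
    simp only [orPair, Set.mem_setOf_eq]
    constructor
    · intro hω
      by_contra hno
      rw [not_or] at hno
      refine not_mem_of_disjoint_esupp hC hCnu ?_ hω
      rw [esC, hIAC1, hIBC1]; ext i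
      simp only [Set.mem_inter_iff, mem_coe, mem_union, Finset.mem_singleton, Set.mem_empty_iff_false, iff_false,
        not_and]
      rintro hi (rfl | rfl)
      · exact hno.1 hi
      · exact hno.2 hi
    · rintro (hs | ht)
      · exact hC (Set.singleton_subset_iff.2 hs) hs₀C
      · exact hC (Set.singleton_subset_iff.2 ht) ht₀C

end Summit.CriticalPhenomena.PercolationContinuityZ3.Theorems
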